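import Summits.AnomalousDissipation.AnomalousDissipation.Theses.LimitingAbsorption

/-!
# `LimitingAbsorption.Assembly` (stmt-AnomalousDissipation-2942): proof

`Summit.AnomalousDissipation.AnomalousDissipation.Theses.LimitingAbsorption.Assembly` is the assembly
item of route `AnomalousDissipation/LimitingAbsorption`:
`RelaxationBoundsInventory → UniformRelaxationWitness → ScalarSectorLift → AnomalousDissipation`.

Proof (pure bookkeeping, self-contained; it is the same term as the route's planner-authored
deciding theorem `…Theses.LimitingAbsorption.closes`, D-0027 §2.1): from `UniformRelaxationWitness`
take the planar force `g`, the source profile `h`, viscosities `ν_j → 0`, data `v₀_j`, the global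
Leray–Hopf solutions `v_j` (locally bounded, `meanEnergy (v_j) ≤ E`), the phase-uniform relaxation
constants `(C, γ)` and the floor `ε` together with, for each `j` (by choice), an `h`-sourced weak
scalar `θ_j` from zero datum whose limsup-mean `ν_j‖∇θ_j‖²` is `≥ ε`.  `RelaxationBoundsInventory`
at `κ = ν_j`, `u = v_j` (with `h ∈ L²` from `IsSmooth.memLp`) bounds the limsup-mean of
`scalarL2Sq (θ_j t)` by `4C/γ² · scalarL2Sq h`, uniformly in `j`; with `θ₀_j := 0`
(`MemLp.zero`) this is exactly the antecedent of `ScalarSectorLift`, which returns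
`AnomalousDissipation`.
-/

-- `Summit.<Summit>.<Problem>` is the tree's mandated summit-side namespace (CONVENTIONS §2); for this
-- single-conjunct summit the two coincide, so the duplicate is deliberate.
set_option linter.dupNamespace false

namespace Summit.AnomalousDissipation.AnomalousDissipation.Theorems

/-- **Assembly of route `LimitingAbsorption`** (item stmt-AnomalousDissipation-2942):
`RelaxationBoundsInventory → UniformRelaxationWitness → ScalarSectorLift → AnomalousDissipation`.
Unpack the uniform-relaxation witness `(g, h, ν, v₀, v, E, C, γ, ε)`, choose for each `j` the
`h`-sourced scalar `θ_j` from zero datum with dissipation floor `ε`, bound its limsup-mean `L²`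
inventory by `4C/γ² · scalarL2Sq h` through `RelaxationBoundsInventory` (`h ∈ L²` by
`IsSmooth.memLp`), set `θ₀_j := 0` (`MemLp.zero`) and feed the resulting scalar-sector witness to
`ScalarSectorLift`. [route AnomalousDissipation/LimitingAbsorption; folklore bookkeeping] -/
theorem limitingAbsorption_assembly_proof :
    Summit.AnomalousDissipation.AnomalousDissipation.Theses.LimitingAbsorption.Assembly := by
  unfold Summit.AnomalousDissipation.AnomalousDissipation.Theses.LimitingAbsorption.Assembly
  intro hInv hX hLift
  obtain ⟨g, h, hg, hgdiv, hgmean, hh, hhmean, ν, v₀, v, hνpos, hνlim, hLH, hbd, ⟨E, hE⟩,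
    ⟨C, γ, hC, hγ, hrelax⟩, ε, hε, hdiss⟩ := hX
  choose θ hθ hθε using hdiss
  refine hLift ⟨g, h, hg, hgdiv, hgmean, hh, hhmean, ν, v₀, v, fun _ => 0, θ, hνpos, hνlim, hLH,
    hbd, fun _ => MeasureTheory.MemLp.zero, hθ, ⟨E, hE⟩,
    ⟨4 * C / γ ^ 2 * Literature.Analysis.FluidPDE.Torus.scalarL2Sq h, fun j => ?_⟩, ε, hε, hθε⟩
  exact hInv (ν j) (v j) h C γ (hνpos j) hC hγ (hh.memLp 2) (hbd j) (hrelax j) (θ j) (hθ j)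

end Summit.AnomalousDissipation.AnomalousDissipation.Theorems
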